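import Literature.MathematicalPhysics.QuantumFieldTheory.Balaban1983to89.B9B8KnitLetterCoercive

/-!
# `Balaban1983to89.B9B8KnitLetterResolvent` — THE TRANSFER ENGINE OF THE JUNCTION: `Δ′_a(U; parSymY) − Δ′_a(U; parKnitY)` is a BLOCK-LOCAL operator of
# size `32(d+1)²α₀′·L^{−2k}` on the class (52), and `G′(U; parKnitY) = G′(U; parSymY) + G′(U; parSymY)∘E∘G′(U; parKnitY)` (junction J-B file 8 —
# the resolvent identity by which every bound proved at def-Y's letter of record passes to print's own transporters)

statement-level skeleton of published theorems with citation tags; proofs where landed; nothing here is a claim about the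
Yang–Mills mass gap

T. Bałaban, *Propagators for lattice gauge theories in a background field*, Commun. Math. Phys. **99** (1985) 389–434 [`Balaban1985BackgroundPropagators`,
"[B9]"]; T. Bałaban, *Propagators and renormalization transformations for lattice gauge theories. II*, Commun. Math. Phys. **96** (1984) 223–250
[`Balaban1984PropagatorsII`, "[4]"]; T. Bałaban, *Averaging operations for lattice gauge theories*, Commun. Math. Phys. **98** (1985) 17–51
[`Balaban1985Averaging`, "[B7]"].

THE PRINT.  [B9] (3.24) p. 394: `Δ′_a(U) = Δ_U + Σ_j a_j(Lʲη)⁻² Q′_j(U)*1_{Λ_j}Q′_j(U)`, (3.19) p. 393: the averaging operators `Q′_j(U)` carry the contour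
variables `U(Γ^{(j)}_{y,x})` *«defined by (52), (53) in [5]»* — the KNIT LETTER `parKnitY` of the junction; def-Y's letter of record `parSymY` (NODE 00's
taxicab contours) is the tree's own reading of (3.19) at which dag-w1 ∕ M5.x proved the estimates.  [B9] p. 409–410 (Thm 3.7, (3.90)) and [4] p. 234
((2.50), (2.66)): *«G′ = G′₀(I − R′)⁻¹ = Σ G′₀R′ⁿ … The expansion is convergent in all norms appearing in the inequalities (3.42)–(3.47)»* — the
resolvent-expansion device this junction reuses with `G′₀ := G′(U; parSymY)`, `R′ := E∘G′(U; parSymY)`.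

WHY THIS FILE ∕ THE ARGUMENT.  The two operators (3.24) at the two letters share the covariant Laplacian; their difference `E` is the difference of the
transported block-averaging kernels, hence BLOCK-DIAGONAL w.r.t. `𝔅` (`(EΛ)(z)` reads `Λ` on the block of `z` only), and on [B7]'s class (52) junction
file 5b (`norm_parKnitY_sub_parSymY_le`: `‖parKnitY − parSymY‖ ≤ 8(d+1)²α₀′(L^{j}∕L^k)²` at corner pairs) prices it: the block coefficient
`levC_j·(L^j)^{d+1} = a_j(L^j)⁻²` ((2.14)) times `4·8(d+1)²α₀′(L^j∕L^k)²` gives `‖(EΛ)(z)‖ ≤ 32(d+1)²α₀′·a_j·(L^k)⁻²·max_{Δ(z)}‖Λ‖` — SMALL AND LEVEL-FREE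
in lattice units.  With both `Δ′`'s invertible (dag-n06-j's `isUnit_deltaPrimeAY_parSymY`, junction file 3's `isUnit_deltaPrimeAY_parKnitY`) the
resolvent identities are pure algebra.  §5 runs the simplest instance of the transfer: a sup → sup bound of `G′` at the letter of record passes to the
knit letter with constant `B∕(1 − B·ε)`.

CITATION HEADER (lean-in-tree rule).  Cell `lit-balaban`, sub-row G-B9-LETTERS, junction J-B (lead RULINGS #3–#4) file 8 → seat `lit-balaban-p33` gen 94.
REUSED BY NAME: `deltaPrimeAY` ∕ `kernelTrOpY_apply` ∕ `avgTrY` ∕ `avgCoeffY_eq_ite` ∕ `cornerY_levY_eq` (def-Y, dag-n06-j), `levC_mul_side_pow`,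
`filter_rblk_eq_filter_blkOf`, `card_filter_rblk` (dag-w1), junction files 1∕4b∕5b∕6 (`parKnitY_inv`, `parKnitY_mem_of_pdev`, `norm_parKnitY_sub_parSymY_le`,
`contraction_of_mem_unitary`), `B9B8AveragedBondsStraight.norm_inv_sub_inv_le`.

WHAT THIS FILE PROVES (sorry-free; no definitions; nothing of [B9] asserted).
* §1 (pure algebra, any monoid with zero ∕ ring): `inverse_eq_add_of_isUnit` (`T₂⁻¹ = T₁⁻¹ + T₁⁻¹(T₁ − T₂)T₂⁻¹`), `inverse_eq_add_of_isUnit'`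
  (`T₂⁻¹ = T₁⁻¹ + T₂⁻¹(T₁ − T₂)T₁⁻¹`); at the letters: `deltaPrimeAY_sub_eq` (`E` = difference of the two `kernelTrOpY`'s), `sub_apply_eq`
  (pointwise), ★ `GpY_parKnitY_eq` ∕ `GpY_parKnitY_eq'` (the two resolvent identities, `G`-valued `U` and knit legs, `G ≤ U(N)`).
* §2 `norm_R_sub_R_le` (`‖R(V)X − R(V′)X‖ ≤ 2‖V − V′‖·‖X‖`, contraction pairs), `norm_avgTrY_sub_le` (`‖τ_sym(z,w) − τ_knit(z,w)‖ ≤ 2δ` on a block where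
  the corner legs differ by `≤ δ`).
* §3 ★★ `norm_sub_apply_le_of_blk` (per block, displayed `δ`), ★★★ **`norm_deltaPrimeAY_sub_apply_le`**: for `G ≤ U(N)` averaging-closed, `G`-valued `U`,
  `0 < α₀′`, `C₀α₀′ ≤ ⅓`, `2α₀′ ≤ c₂′`, `pdev (liftCfg U) < α₀′(L^k)⁻²`, every `Λ`, `z` and `M ≥ 0` with `‖Λ w‖ ≤ M` on the block of `z`:
  `‖(Δ′_a(U; parSymY)Λ − Δ′_a(U; parKnitY)Λ)(z)‖ ≤ 32(d+1)²α₀′·(L^k)⁻²·M`; `deltaPrimeAY_sub_apply_eq_zero` (block-diagonality).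
* §4 ★★ `supBound_GpY_parKnitY_of_parSymY`: a DISPLAYED sup → sup bound `‖(G′(U; parSymY)Ψ)(z)‖ ≤ B·max‖Ψ‖` for all `Ψ` with `B·32(d+1)²α₀′(L^k)⁻² ≤ ½`
  gives `‖(G′(U; parKnitY)Ψ)(z)‖ ≤ 2B·max‖Ψ‖` — the sup half of (E12) at the knit letter INHERITED from the letter of record (no decay weights here;
  the weighted ∕ majorant form is junction file 9).

HONEST SCOPE.  Algebra and one elementary estimate for finite lattice operators; the sup bound of §4 is a transfer under a displayed hypothesis (its
supplier at def-Y's letter is sub-row G-B9-LETTERS' M5.5, `B9Thm37GpTorusRegular*`), not a proof of (3.42); the (52) hypothesis on the lift is carried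
explicitly (file 4b's header).  Count-neutral; nothing continuum, nothing about OS axioms or the mass gap.  No `sorry`, no `axiom`, no `instance`, no
`notation`.  NEW file; nothing landed is modified.  Net new unproved facts: 0.  Seat `lit-balaban-p33` gen 94, 2026-08-28.
-/

noncomputable section

namespace Literature.MathematicalPhysics.QuantumFieldTheory.Balaban1983to89.B9B8KnitLetterResolvent

open Node00 B6KLevelCensusIndexV1 B6Geom246MultiLevelBox B6MultiLevelBoxOperator B6MultiLevelTorusOperator B6GlobalChartV1 B9BackgroundsKLevelV1
  B9Eq39Adjoint B9Thm311ReadingCoords B9Thm311DeltaPrimePos B9Ineq369CurvatureSmallAtLettersY B9Thm31SiteCoerciveGaugeBlockY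
  B9Thm31SiteCoerciveReg335Y
open Literature.MathematicalPhysics.QuantumFieldTheory.Balaban1983to89.B9Thm311DeltaPrimeSymm (avgCoeffY_eq_ite cornerY_levY_eq)
open B7Prop1Explicit (U1 mem_U1)
open B7Prop2Explicit (AvgClosed pdev C0 c2')
open B9B8CarrierDictionary (liftCfg)
open B9B8AveragingJunction (parKnitY parKnitY_inv levY_of_blkOf)
open B9B8KnitLetterRegular (parKnitY_mem_of_pdev)
open B9B8KnitVsTaxicab (norm_parKnitY_sub_parSymY_le)
open B9Thm311PositivityKnitLetter (isUnit_deltaPrimeAY_parKnitY)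
open B9B8KnitLetterCoercive (contraction_of_mem_unitary)
open scoped Matrix Matrix.Norms.L2Operator

variable {d ℓ : ℕ} {hd : 1 ≤ d + 1} {hL : Odd (ℓ + 1) ∧ 1 < ℓ + 1} {b₀ b₁ : ℝ}

/-! ## §1 Algebra: the difference of the two (3.24)'s and the resolvent identities -/

section Algebra

/-- THE SECOND RESOLVENT IDENTITY in a monoid with zero: for units `T₁, T₂`, `T₂⁻¹ = T₁⁻¹ + T₁⁻¹·(T₁ − T₂)·T₂⁻¹` (`Ring.inverse`).
[cite: Balaban1984PropagatorsII, (2.50) p.232 («G′ = G′₀(I − R)⁻¹»), bookkeeping] -/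
theorem inverse_eq_add_of_isUnit {R₀ : Type*} [Ring R₀] {T₁ T₂ : R₀} (h₁ : IsUnit T₁) (h₂ : IsUnit T₂) :
    Ring.inverse T₂ = Ring.inverse T₁ + Ring.inverse T₁ * (T₁ - T₂) * Ring.inverse T₂ := by
  rw [mul_sub, sub_mul, Ring.inverse_mul_cancel _ h₁, one_mul, mul_assoc, Ring.mul_inverse_cancel _ h₂, mul_one]
  abel

/-- THE SECOND RESOLVENT IDENTITY, other order: `T₂⁻¹ = T₁⁻¹ + T₂⁻¹·(T₁ − T₂)·T₁⁻¹`.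
[cite: Balaban1984PropagatorsII, (2.50) p.232, bookkeeping] -/
theorem inverse_eq_add_of_isUnit' {R₀ : Type*} [Ring R₀] {T₁ T₂ : R₀} (h₁ : IsUnit T₁) (h₂ : IsUnit T₂) :
    Ring.inverse T₂ = Ring.inverse T₁ + Ring.inverse T₂ * (T₁ - T₂) * Ring.inverse T₁ := by
  rw [mul_sub, sub_mul, mul_assoc (Ring.inverse T₂) T₁, Ring.mul_inverse_cancel _ h₁, mul_one, Ring.inverse_mul_cancel _ h₂, one_mul]
  abel

variable (i : KIdx d ℓ hd hL b₀ b₁) {𝔸 : Type} [NormedRing 𝔸] [NormedAlgebra ℂ 𝔸] [CompleteSpace 𝔸]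

/-- ★ `E := Δ′_a(U; par₁) − Δ′_a(U; par₂)` IS THE DIFFERENCE OF THE TWO TRANSPORTED AVERAGING KERNELS (the covariant Laplacians cancel).
[cite: Balaban1985BackgroundPropagators, (3.24) p.394, (3.19) p.393] -/
theorem deltaPrimeAY_sub_eq (par₁ par₂ : SiteParY 𝔸 i) (U : CfgY 𝔸 i) :
    deltaPrimeAY i par₁ U - deltaPrimeAY i par₂ U = kernelTrOpY (avgCoeffY i) (avgTrY i par₁ U) - kernelTrOpY (avgCoeffY i) (avgTrY i par₂ U) := by
  rw [deltaPrimeAY, deltaPrimeAY]; abel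

/-- `E`, evaluated: `(EΛ)(z) = Σ_w a(z,w)·(R(τ₁(z,w)) − R(τ₂(z,w)))Λ(w)`. [cite: Balaban1985BackgroundPropagators, (3.24) p.394, bookkeeping] -/
theorem sub_apply_eq (par₁ par₂ : SiteParY 𝔸 i) (U : CfgY 𝔸 i) (Λ : SiteY i → 𝔸) (z : SiteY i) :
    (deltaPrimeAY i par₁ U Λ - deltaPrimeAY i par₂ U Λ) z
      = ∑ w, ((avgCoeffY i z w : ℝ) : ℂ) • (R (avgTrY i par₁ U z w) (Λ w) - R (avgTrY i par₂ U z w) (Λ w)) := by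
  rw [← LinearMap.sub_apply, deltaPrimeAY_sub_eq, LinearMap.sub_apply, Pi.sub_apply, kernelTrOpY_apply, kernelTrOpY_apply, ← Finset.sum_sub_distrib]
  exact Finset.sum_congr rfl fun w _ => (smul_sub _ _ _).symm

end Algebra

section Resolvent

variable (i : KIdx d ℓ hd hL b₀ b₁) {N : ℕ} {G : Subgroup (Matrix (Fin N) (Fin N) ℂ)ˣ}

/-- ★ **THE RESOLVENT IDENTITY AT THE TWO LETTERS**: `G′(U; parKnitY) = G′(U; parSymY) + G′(U; parSymY)∘(Δ′_sym − Δ′_knit)∘G′(U; parKnitY)` for a `G`-valued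
`U` with `G`-valued knit legs, `G ≤ U(N)`. [cite: Balaban1985BackgroundPropagators, (3.25) p.394, (3.90) p.409; Balaban1984PropagatorsII, (2.50) p.232] -/
theorem GpY_parKnitY_eq (hG : G ≤ B7Prop2Explicit.unitaryUnits (Matrix (Fin N) (Fin N) ℂ)) {U : CfgY (Matrix (Fin N) (Fin N) ℂ) i}
    (hU : ∀ μ x, U μ x ∈ G) (hpar : ∀ z w : SiteY i, parKnitY i U z w ∈ G) :
    GpY i (parKnitY i) U = GpY i (parSymY i) U
      + GpY i (parSymY i) U * (deltaPrimeAY i (parSymY i) U - deltaPrimeAY i (parKnitY i) U) * GpY i (parKnitY i) U :=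
  inverse_eq_add_of_isUnit (isUnit_deltaPrimeAY_parSymY i hG hU) (isUnit_deltaPrimeAY_parKnitY i hG hU hpar)

/-- ★ the resolvent identity, other order: `G′(U; parKnitY) = G′(U; parSymY) + G′(U; parKnitY)∘(Δ′_sym − Δ′_knit)∘G′(U; parSymY)`.
[cite: Balaban1985BackgroundPropagators, (3.25) p.394, (3.90) p.409; Balaban1984PropagatorsII, (2.50) p.232] -/
theorem GpY_parKnitY_eq' (hG : G ≤ B7Prop2Explicit.unitaryUnits (Matrix (Fin N) (Fin N) ℂ)) {U : CfgY (Matrix (Fin N) (Fin N) ℂ) i}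
    (hU : ∀ μ x, U μ x ∈ G) (hpar : ∀ z w : SiteY i, parKnitY i U z w ∈ G) :
    GpY i (parKnitY i) U = GpY i (parSymY i) U
      + GpY i (parKnitY i) U * (deltaPrimeAY i (parSymY i) U - deltaPrimeAY i (parKnitY i) U) * GpY i (parSymY i) U :=
  inverse_eq_add_of_isUnit' (isUnit_deltaPrimeAY_parSymY i hG hU) (isUnit_deltaPrimeAY_parKnitY i hG hU hpar)

end Resolvent

/-! ## §2 Two conjugations, two transporters -/

section Norms

variable {N : ℕ}

/-- ★ TWO CONJUGATIONS IN OPERATOR NORM: for contraction pairs `V, V′` with `‖V − V′‖ ≤ δ`, `‖R(V)X − R(V′)X‖ ≤ 2δ·‖X‖`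
(`R(V)X − R(V′)X = (V − V′)XV⁻¹ + V′X(V⁻¹ − V′⁻¹)`). [cite: Balaban1985Averaging, (17)–(20) pp.20–21, bookkeeping] -/
theorem norm_R_sub_R_le [Nonempty (Fin N)] {V V' : (Matrix (Fin N) (Fin N) ℂ)ˣ}
    (hV : ‖(V : Matrix (Fin N) (Fin N) ℂ)‖ ≤ 1 ∧ ‖((V⁻¹ : (Matrix (Fin N) (Fin N) ℂ)ˣ) : Matrix (Fin N) (Fin N) ℂ)‖ ≤ 1)
    (hV' : ‖(V' : Matrix (Fin N) (Fin N) ℂ)‖ ≤ 1 ∧ ‖((V'⁻¹ : (Matrix (Fin N) (Fin N) ℂ)ˣ) : Matrix (Fin N) (Fin N) ℂ)‖ ≤ 1)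
    {δ : ℝ} (hδ : ‖(V : Matrix (Fin N) (Fin N) ℂ) - V'‖ ≤ δ) (X : Matrix (Fin N) (Fin N) ℂ) :
    ‖R V X - R V' X‖ ≤ 2 * δ * ‖X‖ := by
  set Vm : Matrix (Fin N) (Fin N) ℂ := (V : Matrix (Fin N) (Fin N) ℂ)
  set Vi : Matrix (Fin N) (Fin N) ℂ := ((V⁻¹ : (Matrix (Fin N) (Fin N) ℂ)ˣ) : Matrix (Fin N) (Fin N) ℂ)
  set Wm : Matrix (Fin N) (Fin N) ℂ := (V' : Matrix (Fin N) (Fin N) ℂ)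
  set Wi : Matrix (Fin N) (Fin N) ℂ := ((V'⁻¹ : (Matrix (Fin N) (Fin N) ℂ)ˣ) : Matrix (Fin N) (Fin N) ℂ)
  have hsplit : R V X - R V' X = (Vm - Wm) * X * Vi + Wm * X * (Vi - Wi) := by
    rw [R_def, R_def]; noncomm_ring
  have hinv : ‖Vi - Wi‖ ≤ δ :=
    (B9B8AveragedBondsStraight.norm_inv_sub_inv_le (u := V) (v := V') (mem_U1.2 hV) (mem_U1.2 hV')).trans hδ
  have hX := norm_nonneg X
  have hδ0 : 0 ≤ δ := le_trans (norm_nonneg _) hδ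
  rw [hsplit]
  refine (norm_add_le _ _).trans ?_
  have h1 : ‖(Vm - Wm) * X * Vi‖ ≤ δ * ‖X‖ := by
    calc ‖(Vm - Wm) * X * Vi‖ ≤ ‖Vm - Wm‖ * ‖X‖ * ‖Vi‖ := norm_mul₃_le
      _ ≤ δ * ‖X‖ * 1 := mul_le_mul (mul_le_mul_of_nonneg_right hδ hX) hV.2 (norm_nonneg _) (by positivity)
      _ = δ * ‖X‖ := mul_one _
  have h2 : ‖Wm * X * (Vi - Wi)‖ ≤ δ * ‖X‖ := by
    calc ‖Wm * X * (Vi - Wi)‖ ≤ ‖Wm‖ * ‖X‖ * ‖Vi - Wi‖ := norm_mul₃_le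
      _ ≤ 1 * ‖X‖ * δ := mul_le_mul (mul_le_mul_of_nonneg_right hV'.1 hX) hinv (norm_nonneg _) (by positivity)
      _ = δ * ‖X‖ := by ring
  linarith

/-- TWO TRANSPORTERS: for contraction pairs `a, a′, c, c′` with `‖a − a′‖ ≤ δ`, `‖c − c′‖ ≤ δ`: `‖a⁻¹c − a′⁻¹c′‖ ≤ 2δ`.
[cite: Balaban1985Averaging, (17)–(20) pp.20–21, bookkeeping] -/
theorem norm_invMul_sub_le [Nonempty (Fin N)] {a a' c c' : (Matrix (Fin N) (Fin N) ℂ)ˣ}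
    (ha : ‖(a : Matrix (Fin N) (Fin N) ℂ)‖ ≤ 1 ∧ ‖((a⁻¹ : (Matrix (Fin N) (Fin N) ℂ)ˣ) : Matrix (Fin N) (Fin N) ℂ)‖ ≤ 1)
    (ha' : ‖(a' : Matrix (Fin N) (Fin N) ℂ)‖ ≤ 1 ∧ ‖((a'⁻¹ : (Matrix (Fin N) (Fin N) ℂ)ˣ) : Matrix (Fin N) (Fin N) ℂ)‖ ≤ 1)
    (hc : ‖(c : Matrix (Fin N) (Fin N) ℂ)‖ ≤ 1 ∧ ‖((c⁻¹ : (Matrix (Fin N) (Fin N) ℂ)ˣ) : Matrix (Fin N) (Fin N) ℂ)‖ ≤ 1)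
    {δ : ℝ} (hδa : ‖(a : Matrix (Fin N) (Fin N) ℂ) - a'‖ ≤ δ) (hδc : ‖(c : Matrix (Fin N) (Fin N) ℂ) - c'‖ ≤ δ) :
    ‖((a⁻¹ * c : (Matrix (Fin N) (Fin N) ℂ)ˣ) : Matrix (Fin N) (Fin N) ℂ) - ((a'⁻¹ * c' : (Matrix (Fin N) (Fin N) ℂ)ˣ) : Matrix (Fin N) (Fin N) ℂ)‖ ≤ 2 * δ := by
  set ai : Matrix (Fin N) (Fin N) ℂ := ((a⁻¹ : (Matrix (Fin N) (Fin N) ℂ)ˣ) : Matrix (Fin N) (Fin N) ℂ)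
  set ai' : Matrix (Fin N) (Fin N) ℂ := ((a'⁻¹ : (Matrix (Fin N) (Fin N) ℂ)ˣ) : Matrix (Fin N) (Fin N) ℂ)
  set cm : Matrix (Fin N) (Fin N) ℂ := (c : Matrix (Fin N) (Fin N) ℂ)
  set cm' : Matrix (Fin N) (Fin N) ℂ := (c' : Matrix (Fin N) (Fin N) ℂ)
  have hinv : ‖ai - ai'‖ ≤ δ :=
    (B9B8AveragedBondsStraight.norm_inv_sub_inv_le (u := a) (v := a') (mem_U1.2 ha) (mem_U1.2 ha')).trans hδa
  have hsplit : ((a⁻¹ * c : (Matrix (Fin N) (Fin N) ℂ)ˣ) : Matrix (Fin N) (Fin N) ℂ) - ((a'⁻¹ * c' : (Matrix (Fin N) (Fin N) ℂ)ˣ) : Matrix (Fin N) (Fin N) ℂ)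
      = (ai - ai') * cm + ai' * (cm - cm') := by
    rw [Units.val_mul, Units.val_mul]; noncomm_ring
  rw [hsplit]
  refine (norm_add_le _ _).trans ?_
  have h1 : ‖(ai - ai') * cm‖ ≤ δ := by
    calc ‖(ai - ai') * cm‖ ≤ ‖ai - ai'‖ * ‖cm‖ := norm_mul_le _ _
      _ ≤ δ * 1 := mul_le_mul hinv hc.1 (norm_nonneg _) (le_trans (norm_nonneg _) hinv)
      _ = δ := mul_one _
  have h2 : ‖ai' * (cm - cm')‖ ≤ δ := by
    calc ‖ai' * (cm - cm')‖ ≤ ‖ai'‖ * ‖cm - cm'‖ := norm_mul_le _ _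
      _ ≤ 1 * δ := mul_le_mul ha'.2 hδc (norm_nonneg _) zero_le_one
      _ = δ := one_mul _
  linarith

end Norms

/-! ## §3 `E` is block-local and small on the class (52) -/

section Size

variable (i : KIdx d ℓ hd hL b₀ b₁) {N : ℕ} {G : Subgroup (Matrix (Fin N) (Fin N) ℂ)ˣ}

/-- the averaging transporter at an inverse-symmetric letter, through the block's corner: `τ(z,w) = par(c,z)⁻¹·par(c,w)`, `c` the corner of the block of `z`.
[cite: Balaban1985BackgroundPropagators, (3.19) p.393, (3.24) p.394, bookkeeping] -/
theorem avgTrY_eq_inv_mul (par : SiteParY (Matrix (Fin N) (Fin N) ℂ) i) (U : CfgY (Matrix (Fin N) (Fin N) ℂ) i)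
    (hinv : ∀ z z' : SiteY i, par U z z' = (par U z' z)⁻¹) (z w : SiteY i) :
    avgTrY i par U z w = (par U (blkCornerY i (blkOf i.D.toDomains z)) z)⁻¹ * par U (blkCornerY i (blkOf i.D.toDomains z)) w := by
  rw [avgTrY, cornerY_levY_eq, hinv z]

/-- ★★ **`E` ON ONE BLOCK, WITH A DISPLAYED LEG DEFECT**: if on the block `s` of `z` the knit legs and def-Y's legs from the corner are contraction pairs
differing by `≤ δ`, and `‖Λ w‖ ≤ M` on `s`, then `‖(Δ′_a(U; parSymY)Λ − Δ′_a(U; parKnitY)Λ)(z)‖ ≤ 4δ·a_{j(s)}·(L^{j(s)})⁻²·M`.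
[cite: Balaban1985BackgroundPropagators, (3.24) p.394, (3.19) p.393; Balaban1984PropagatorsII, (2.14) p.225] -/
theorem norm_sub_apply_le_of_blk [Nonempty (Fin N)] (U : CfgY (Matrix (Fin N) (Fin N) ℂ) i) {z : SiteY i} {s : BlkY i}
    (hz : blkOf i.D.toDomains z = s) {δ M : ℝ} (hδ0 : 0 ≤ δ)
    (hK : ∀ w : SiteY i, blkOf i.D.toDomains w = s →
      ‖(parKnitY i U (blkCornerY i s) w : Matrix (Fin N) (Fin N) ℂ)‖ ≤ 1 ∧ ‖(((parKnitY i U (blkCornerY i s) w)⁻¹ : (Matrix (Fin N) (Fin N) ℂ)ˣ) : Matrix (Fin N) (Fin N) ℂ)‖ ≤ 1)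
    (hS : ∀ w : SiteY i, blkOf i.D.toDomains w = s →
      ‖(parSymY i U (blkCornerY i s) w : Matrix (Fin N) (Fin N) ℂ)‖ ≤ 1 ∧ ‖(((parSymY i U (blkCornerY i s) w)⁻¹ : (Matrix (Fin N) (Fin N) ℂ)ˣ) : Matrix (Fin N) (Fin N) ℂ)‖ ≤ 1)
    (hd : ∀ w : SiteY i, blkOf i.D.toDomains w = s →
      ‖(parSymY i U (blkCornerY i s) w : Matrix (Fin N) (Fin N) ℂ) - parKnitY i U (blkCornerY i s) w‖ ≤ δ)
    {Λ : SiteY i → Matrix (Fin N) (Fin N) ℂ} (hΛ : ∀ w : SiteY i, blkOf i.D.toDomains w = s → ‖Λ w‖ ≤ M) :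
    ‖(deltaPrimeAY i (parSymY i) U Λ - deltaPrimeAY i (parKnitY i) U Λ) z‖
      ≤ 4 * δ * (aPrinted ℓ 1 s.1.1 * ((((ℓ + 1) ^ s.1.1 : ℕ) : ℝ) ^ 2)⁻¹) * M := by
  classical
  rw [sub_apply_eq]
  set B := Finset.univ.filter (fun w : SiteY i => blkOf i.D.toDomains w = s) with hB
  have hmem : ∀ {w}, w ∈ B → blkOf i.D.toDomains w = s := fun {w} hw => by simpa [hB] using hw
  -- the sum lives on the block of `z`
  have hsum : ∑ w, ((avgCoeffY i z w : ℝ) : ℂ) • (R (avgTrY i (parSymY i) U z w) (Λ w) - R (avgTrY i (parKnitY i) U z w) (Λ w))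
      = ∑ w ∈ B, ((levC d ℓ (aPrinted ℓ 1) s.1.1 : ℝ) : ℂ) • (R (avgTrY i (parSymY i) U z w) (Λ w) - R (avgTrY i (parKnitY i) U z w) (Λ w)) := by
    rw [← Finset.sum_filter_add_sum_filter_not Finset.univ (fun w : SiteY i => blkOf i.D.toDomains w = s)]
    have h0 : ∑ w ∈ Finset.univ.filter (fun w : SiteY i => ¬ blkOf i.D.toDomains w = s),
        ((avgCoeffY i z w : ℝ) : ℂ) • (R (avgTrY i (parSymY i) U z w) (Λ w) - R (avgTrY i (parKnitY i) U z w) (Λ w)) = 0 :=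
      Finset.sum_eq_zero fun w hw => by
        have hw' : ¬ blkOf i.D.toDomains w = s := (Finset.mem_filter.1 hw).2
        rw [avgCoeffY_eq_ite, if_neg (by rw [hz]; exact hw'), Complex.ofReal_zero, zero_smul]
    rw [h0, add_zero]
    refine Finset.sum_congr rfl fun w hw => ?_
    rw [avgCoeffY_eq_ite, if_pos (by rw [hz]; exact hmem hw), levY_of_blkOf i hz]
  rw [hsum, ← Finset.smul_sum]
  -- each term: two conjugations by transporters differing by `≤ 2δ`
  have hterm : ∀ w ∈ B, ‖R (avgTrY i (parSymY i) U z w) (Λ w) - R (avgTrY i (parKnitY i) U z w) (Λ w)‖ ≤ 2 * (2 * δ) * M := by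
    intro w hw
    have hw := hmem hw
    have hτs : avgTrY i (parSymY i) U z w = (parSymY i U (blkCornerY i s) z)⁻¹ * parSymY i U (blkCornerY i s) w := by
      rw [avgTrY_eq_inv_mul i (parSymY i) U (parSymY_inv_symm U), hz]
    have hτk : avgTrY i (parKnitY i) U z w = (parKnitY i U (blkCornerY i s) z)⁻¹ * parKnitY i U (blkCornerY i s) w := by
      rw [avgTrY_eq_inv_mul i (parKnitY i) U (parKnitY_inv i U), hz]
    have hdiff : ‖(avgTrY i (parSymY i) U z w : Matrix (Fin N) (Fin N) ℂ) - avgTrY i (parKnitY i) U z w‖ ≤ 2 * δ := by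
      rw [hτs, hτk]
      exact norm_invMul_sub_le (hS z hz) (hK z hz) (hS w hw) (hd z hz) (hd w hw)
    have hcs : ‖(avgTrY i (parSymY i) U z w : Matrix (Fin N) (Fin N) ℂ)‖ ≤ 1
        ∧ ‖(((avgTrY i (parSymY i) U z w)⁻¹ : (Matrix (Fin N) (Fin N) ℂ)ˣ) : Matrix (Fin N) (Fin N) ℂ)‖ ≤ 1 := by
      rw [hτs]
      exact mem_U1.1 (Subgroup.mul_mem _ (Subgroup.inv_mem _ (mem_U1.2 (hS z hz))) (mem_U1.2 (hS w hw)))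
    have hck : ‖(avgTrY i (parKnitY i) U z w : Matrix (Fin N) (Fin N) ℂ)‖ ≤ 1
        ∧ ‖(((avgTrY i (parKnitY i) U z w)⁻¹ : (Matrix (Fin N) (Fin N) ℂ)ˣ) : Matrix (Fin N) (Fin N) ℂ)‖ ≤ 1 := by
      rw [hτk]
      exact mem_U1.1 (Subgroup.mul_mem _ (Subgroup.inv_mem _ (mem_U1.2 (hK z hz))) (mem_U1.2 (hK w hw)))
    exact (norm_R_sub_R_le hcs hck hdiff (Λ w)).trans (mul_le_mul_of_nonneg_left (hΛ w hw) (by positivity))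
  have hcard : (B.card : ℝ) = (((ℓ + 1) ^ s.1.1 : ℕ) : ℝ) ^ (d + 1) := by
    rw [hB, ← filter_rblk_eq_filter_blkOf i s,
      B4Lower18.card_filter_rblk (le_trans one_le_two (two_le_side i s)) (isBlockUnion_XB i (scale_bounds i.D.toDomains s).2)]
    push_cast; ring
  have hκ : 0 ≤ levC d ℓ (aPrinted ℓ 1) s.1.1 := (levC_blk_pos i s).le
  calc ‖((levC d ℓ (aPrinted ℓ 1) s.1.1 : ℝ) : ℂ) • ∑ w ∈ B, (R (avgTrY i (parSymY i) U z w) (Λ w) - R (avgTrY i (parKnitY i) U z w) (Λ w))‖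
      ≤ levC d ℓ (aPrinted ℓ 1) s.1.1 * ∑ w ∈ B, ‖R (avgTrY i (parSymY i) U z w) (Λ w) - R (avgTrY i (parKnitY i) U z w) (Λ w)‖ := by
        rw [norm_smul, Complex.norm_real, Real.norm_of_nonneg hκ]
        exact mul_le_mul_of_nonneg_left (norm_sum_le _ _) hκ
    _ ≤ levC d ℓ (aPrinted ℓ 1) s.1.1 * ∑ _w ∈ B, 2 * (2 * δ) * M := mul_le_mul_of_nonneg_left (Finset.sum_le_sum hterm) hκ
    _ = levC d ℓ (aPrinted ℓ 1) s.1.1 * (((ℓ + 1) ^ s.1.1 : ℕ) : ℝ) ^ (d + 1) * (4 * δ * M) := by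
        rw [Finset.sum_const, nsmul_eq_mul, hcard]; ring
    _ = 4 * δ * (aPrinted ℓ 1 s.1.1 * ((((ℓ + 1) ^ s.1.1 : ℕ) : ℝ) ^ 2)⁻¹) * M := by rw [levC_mul_side_pow i s]; ring

/-- ★★★ **`E = Δ′_a(U; parSymY) − Δ′_a(U; parKnitY)` IS SMALL ON THE CLASS (52), LEVEL-FREE IN LATTICE UNITS**: for `G ≤ U(N)` averaging-closed, `N ≥ 1`,
a `G`-valued `U` with `pdev (liftCfg U) < α₀′(L^k)⁻²`, `0 < α₀′`, `C₀α₀′ ≤ ⅓`, `2α₀′ ≤ c₂′`, and `‖Λ w‖ ≤ M` (`M ≥ 0`) on the block of `z`: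
`‖(EΛ)(z)‖ ≤ 32(d+1)²α₀′·(L^k)⁻²·M`. [cite: Balaban1985BackgroundPropagators, (3.24) p.394, (3.19) p.393; Balaban1985Averaging, (52)–(53) pp.26–27; Balaban1984PropagatorsII, (2.14) p.225] -/
theorem norm_deltaPrimeAY_sub_apply_le [Nonempty (Fin N)] (hG : G ≤ B7Prop2Explicit.unitaryUnits (Matrix (Fin N) (Fin N) ℂ))
    (hGa : AvgClosed (d + 1) (ℓ + 1) G) {U : CfgY (Matrix (Fin N) (Fin N) ℂ) i} (hU : ∀ μ x, U μ x ∈ G)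
    {α₀' : ℝ} (hα : 0 < α₀') (hα3 : C0 (d + 1) * α₀' ≤ 1 / 3) (hα2 : 2 * α₀' ≤ c2' (d + 1) (ℓ + 1))
    (h52 : pdev (liftCfg U) < α₀' * ((((ℓ + 1 : ℕ) : ℝ) ^ i.k)⁻¹) ^ 2) (Λ : SiteY i → Matrix (Fin N) (Fin N) ℂ) (z : SiteY i)
    {M : ℝ} (hM : 0 ≤ M) (hΛ : ∀ w : SiteY i, blkOf i.D.toDomains w = blkOf i.D.toDomains z → ‖Λ w‖ ≤ M) :
    ‖(deltaPrimeAY i (parSymY i) U Λ - deltaPrimeAY i (parKnitY i) U Λ) z‖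
      ≤ 32 * ((d : ℝ) + 1) ^ 2 * α₀' * (((((ℓ + 1) ^ i.k : ℕ) : ℝ)) ^ 2)⁻¹ * M := by
  have hd1 : 1 ≤ d + 1 := Nat.succ_pos d
  set s := blkOf i.D.toDomains z with hsdef
  have hparK : ∀ z w : SiteY i, parKnitY i U z w ∈ G := fun z w => parKnitY_mem_of_pdev i hGa hU hα hα3 hα2 h52 z w
  have h52' : pdev (liftCfg U) < α₀' * ((((ℓ : ℝ) + 1) ^ i.k)⁻¹) ^ 2 := by push_cast at h52; exact h52
  set δ : ℝ := 8 * ((d : ℝ) + 1) ^ 2 * α₀' * ((((ℓ : ℝ) + 1) ^ s.1.1) ^ 2 * ((((ℓ : ℝ) + 1) ^ i.k)⁻¹) ^ 2) with hδdef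
  have hδ0 : 0 ≤ δ := by positivity
  have hmain := norm_sub_apply_le_of_blk i U rfl hδ0 (fun w _ => contraction_of_mem_unitary hG (hparK _ _))
    (fun w _ => contraction_of_mem_unitary hG (parSymY_mem i hU _ _))
    (fun w hw => by rw [norm_sub_rev]; exact norm_parKnitY_sub_parSymY_le i hd1 hGa hU hα hα3 hα2 h52' hw) hΛ
  refine hmain.trans ?_
  -- `4δ·a_j·n⁻² = 32(d+1)²α₀′·a_j·(L^k)⁻² ≤ 32(d+1)²α₀′(L^k)⁻²`
  have ha1 : aPrinted ℓ 1 s.1.1 ≤ 1 := B6Prop23KLevelTorusCensus.aPrinted_le_one (by have := i.hℓ; omega) _ (one_le_level i s)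
  have ha0 : 0 ≤ aPrinted ℓ 1 s.1.1 := (B6Prop23KLevelTorusCensus.aPrinted_pos (by have := i.hℓ; omega) _ (one_le_level i s)).le
  have hn : (0 : ℝ) < (((ℓ + 1) ^ s.1.1 : ℕ) : ℝ) := by positivity
  have e1 : (((ℓ : ℝ) + 1) ^ s.1.1) = (((ℓ + 1) ^ s.1.1 : ℕ) : ℝ) := by push_cast; ring
  have e2 : (((ℓ : ℝ) + 1) ^ i.k) = (((ℓ + 1) ^ i.k : ℕ) : ℝ) := by push_cast; ring
  have e : 4 * δ * (aPrinted ℓ 1 s.1.1 * ((((ℓ + 1) ^ s.1.1 : ℕ) : ℝ) ^ 2)⁻¹) * M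
      = 32 * ((d : ℝ) + 1) ^ 2 * α₀' * (((((ℓ + 1) ^ i.k : ℕ) : ℝ)) ^ 2)⁻¹ * M * aPrinted ℓ 1 s.1.1 := by
    rw [hδdef, e1, e2]
    field_simp
    ring
  rw [e]
  have h0 : 0 ≤ 32 * ((d : ℝ) + 1) ^ 2 * α₀' * (((((ℓ + 1) ^ i.k : ℕ) : ℝ)) ^ 2)⁻¹ * M := by positivity
  calc _ ≤ 32 * ((d : ℝ) + 1) ^ 2 * α₀' * (((((ℓ + 1) ^ i.k : ℕ) : ℝ)) ^ 2)⁻¹ * M * 1 := mul_le_mul_of_nonneg_left ha1 h0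
    _ = _ := mul_one _

/-- `E` IS BLOCK-DIAGONAL: if `Λ` vanishes on the block of `z` then `(EΛ)(z) = 0` (any two letters). [cite: Balaban1985BackgroundPropagators, (3.24) p.394, (3.19) p.393] -/
theorem deltaPrimeAY_sub_apply_eq_zero (par₁ par₂ : SiteParY (Matrix (Fin N) (Fin N) ℂ) i) (U : CfgY (Matrix (Fin N) (Fin N) ℂ) i)
    (Λ : SiteY i → Matrix (Fin N) (Fin N) ℂ) (z : SiteY i) (hΛ : ∀ w : SiteY i, blkOf i.D.toDomains w = blkOf i.D.toDomains z → Λ w = 0) :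
    (deltaPrimeAY i par₁ U Λ - deltaPrimeAY i par₂ U Λ) z = 0 := by
  rw [sub_apply_eq]
  refine Finset.sum_eq_zero fun w _ => ?_
  by_cases hw : blkOf i.D.toDomains w = blkOf i.D.toDomains z
  · rw [hΛ w hw, R_zero, R_zero, sub_zero, smul_zero]
  · rw [avgCoeffY_eq_ite, if_neg hw, Complex.ofReal_zero, zero_smul]

end Size

/-! ## §4 The simplest transfer: a sup → sup bound of `G′` passes from def-Y's letter to the knit letter -/

section Sup

variable (i : KIdx d ℓ hd hL b₀ b₁) {N : ℕ} {G : Subgroup (Matrix (Fin N) (Fin N) ℂ)ˣ}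

/-- ★★ **THE SUP HALF OF (E12) AT THE KNIT LETTER, INHERITED**: for `G ≤ U(N)` averaging-closed, `N ≥ 1`, a `G`-valued `U` on the class (52) as above, a
DISPLAYED sup → sup bound at def-Y's letter `‖(G′(U; parSymY)Ψ)(z)‖ ≤ B·M` whenever `‖Ψ‖ ≤ M` pointwise (`M ≥ 0`), and the smallness
`B·32(d+1)²α₀′(L^k)⁻² ≤ ½`: `‖(G′(U; parKnitY)Ψ)(z)‖ ≤ 2B·M` whenever `‖Ψ‖ ≤ M` pointwise.
[cite: Balaban1985BackgroundPropagators, Thm 3.1 (3.42) p.397, (3.90) p.409 («convergent in all norms»); Balaban1985RegularSpaces, (1.101) p.93] -/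
theorem supBound_GpY_parKnitY_of_parSymY [Nonempty (Fin N)] (hG : G ≤ B7Prop2Explicit.unitaryUnits (Matrix (Fin N) (Fin N) ℂ))
    (hGa : AvgClosed (d + 1) (ℓ + 1) G) {U : CfgY (Matrix (Fin N) (Fin N) ℂ) i} (hU : ∀ μ x, U μ x ∈ G)
    {α₀' : ℝ} (hα : 0 < α₀') (hα3 : C0 (d + 1) * α₀' ≤ 1 / 3) (hα2 : 2 * α₀' ≤ c2' (d + 1) (ℓ + 1))
    (h52 : pdev (liftCfg U) < α₀' * ((((ℓ + 1 : ℕ) : ℝ) ^ i.k)⁻¹) ^ 2) {B : ℝ}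
    (hGs : ∀ (Ψ : SiteY i → Matrix (Fin N) (Fin N) ℂ) (M : ℝ), 0 ≤ M → (∀ w, ‖Ψ w‖ ≤ M) → ∀ z, ‖GpY i (parSymY i) U Ψ z‖ ≤ B * M)
    (hsmall : B * (32 * ((d : ℝ) + 1) ^ 2 * α₀' * (((((ℓ + 1) ^ i.k : ℕ) : ℝ)) ^ 2)⁻¹) ≤ 1 / 2)
    (Ψ : SiteY i → Matrix (Fin N) (Fin N) ℂ) {M : ℝ} (hM : 0 ≤ M) (hΨ : ∀ w, ‖Ψ w‖ ≤ M) (z : SiteY i) :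
    ‖GpY i (parKnitY i) U Ψ z‖ ≤ 2 * B * M := by
  classical
  have hparK : ∀ z w : SiteY i, parKnitY i U z w ∈ G := fun z w => parKnitY_mem_of_pdev i hGa hU hα hα3 hα2 h52 z w
  set Φ := GpY i (parKnitY i) U Ψ with hΦdef
  -- the sup of `‖Φ‖` over the finite lattice
  have hne : (Finset.univ : Finset (SiteY i)).Nonempty := ⟨z, Finset.mem_univ _⟩
  set X : ℝ := Finset.univ.sup' hne (fun w => ‖Φ w‖) with hXdef
  have hXw : ∀ w, ‖Φ w‖ ≤ X := fun w => Finset.le_sup' (fun w => ‖Φ w‖) (Finset.mem_univ w)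
  have hX0 : 0 ≤ X := le_trans (norm_nonneg _) (hXw z)
  -- the resolvent identity `Φ = G′_symΨ + G′_sym (E Φ)`
  set ε : ℝ := 32 * ((d : ℝ) + 1) ^ 2 * α₀' * (((((ℓ + 1) ^ i.k : ℕ) : ℝ)) ^ 2)⁻¹ with hεdef
  have hE : ∀ w, ‖(deltaPrimeAY i (parSymY i) U Φ - deltaPrimeAY i (parKnitY i) U Φ) w‖ ≤ ε * X := fun w =>
    norm_deltaPrimeAY_sub_apply_le i hG hGa hU hα hα3 hα2 h52 Φ w hX0 (fun w' _ => hXw w')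
  have hid : Φ = GpY i (parSymY i) U Ψ + GpY i (parSymY i) U (deltaPrimeAY i (parSymY i) U Φ - deltaPrimeAY i (parKnitY i) U Φ) := by
    have h := congrArg (fun T => T Ψ) (GpY_parKnitY_eq i hG hU hparK)
    simp only [LinearMap.add_apply, Module.End.mul_apply, LinearMap.sub_apply] at h
    rw [hΦdef]
    convert h using 2
  have hall : ∀ w, ‖Φ w‖ ≤ B * M + B * (ε * X) := by
    intro w
    have h1 := hGs Ψ M hM hΨ w
    have h2 := hGs _ (ε * X) (by positivity) hE w
    calc ‖Φ w‖ = ‖(GpY i (parSymY i) U Ψ + GpY i (parSymY i) U (deltaPrimeAY i (parSymY i) U Φ - deltaPrimeAY i (parKnitY i) U Φ)) w‖ := by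
          rw [← hid]
      _ ≤ _ := (norm_add_le _ _).trans (add_le_add h1 h2)
  -- absorb
  obtain ⟨w₀, _, hw₀⟩ := Finset.exists_mem_eq_sup' hne (fun w => ‖Φ w‖)
  have hXle : X ≤ B * M + B * (ε * X) := (hXdef.trans hw₀).trans_le (hall w₀)
  have hBε : B * (ε * X) ≤ (1 / 2) * X := by
    rw [← mul_assoc]; exact mul_le_mul_of_nonneg_right hsmall hX0
  have hX2 : X ≤ 2 * B * M := by nlinarith [hXle, hBε, hX0]
  exact (hXw z).trans hX2

end Sup

end Literature.MathematicalPhysics.QuantumFieldTheory.Balaban1983to89.B9B8KnitLetterResolvent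

end
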